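import Summits.BirchSwinnertonDyer.BirchSwinnertonDyer.Theorems.EisensteinDepletionAtTwoStarKummerSqrtFormSigmaCore
import Summits.BirchSwinnertonDyer.BirchSwinnertonDyer.Theorems.EisensteinDepletionAtTwoStarOptBNSFKummerFn
import Summits.BirchSwinnertonDyer.BirchSwinnertonDyer.Theorems.EisensteinDepletionAtTwoStarOptBNSFX1Denominator
import Summits.BirchSwinnertonDyer.BirchSwinnertonDyer.Theorems.EisensteinDepletionAtTwoStarOptBNSFKummerQExp
import Summits.BirchSwinnertonDyer.BirchSwinnertonDyer.Theorems.EisensteinDepletionAtTwoStarOptBNSFKummerAlg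
import Summits.BirchSwinnertonDyer.BirchSwinnertonDyer.Theorems.EisensteinDepletionAtTwoStarOptBNSFParamExpansion
import Summits.BirchSwinnertonDyer.BirchSwinnertonDyer.Theorems.EisensteinDepletionAtTwoStarKummerDefs
import Literature.RingTheory.PowerSeries.NthRootDenominatorType
import Literature.NumberTheory.EllipticCurves.TwoTorsionHalfPeriodProofs
import HarnessLib

/-!
# Line `kummer` v7, stub K-A `stub_kummerSqrtFormSigma` — PROVED (crux `StarGO2Sigma`, stmt-BirchSwinnertonDyer-27046;
# lead bsd-rank2-star-p1 GEN 13)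

THE ANTI-INVARIANT CUSP FORM OF THE DISCREPANCY COVER (registered signature verbatim).  Assembly of landed engines:
`KummerFn.stub_kummerFn` (the Kummer function), `X1Denominator.stub_x1Denominator` (the rational `Γ₁(N)`-denominator),
`ParityGroup.exists_parityGroup` + `KummerForm.stub_kummerForm` (the Kummer form `hκ` on the UNTWISTED parity group),
`KummerSigma.twistedCuspForm` (Core: `h = u·hκ` on the twisted group `Γ″`), `KummerQExp.stub_kummerQExp` (the `q`-expansion
identities) and the integrality ALGEBRA in the pattern of `KummerAlg.stub_kummerAlg`, where the `2`-adic input «`B` half-integral»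
of the formal case is replaced by the eta–Kummer square identity (Θ) and the `η`-side identity `U² = q^{2m}Θ_N E²`:
`(q·X·P(h))² = (X^m·E·R·PG₁)²`, so `q·D·P(h) = ±X^m·E·R·Y·(D·PΦ₁)·X·v² ∈ ℤ⟦q⟧` (`Y = X_W(z)⁻¹`, `z = X·v`).
No number theory beyond the hypotheses; nothing here reads `r_an`; `StarGO2Sigma` / E1M / BSD are NOT proved by this file.
-/

set_option linter.dupNamespace false
set_option autoImplicit false

noncomputable section

open Complex Filter Topology Set Function
open UpperHalfPlane hiding I
open scoped Real Topology Manifold MatrixGroups ModularForm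
open ModularForm CongruenceSubgroup PowerSeries
open Literature.NumberTheory.EllipticCurves Literature.NumberTheory.EllipticCurves.ModularForms
open Literature.NumberTheory.EllipticCurves.Greenberg1999
open Summit.BirchSwinnertonDyer.BirchSwinnertonDyer.Theorems.DepletionAtTwo
open Summit.BirchSwinnertonDyer.BirchSwinnertonDyer.Theorems.DepletionAtTwo.KummerAlg

namespace Summit.BirchSwinnertonDyer.BirchSwinnertonDyer.Theorems.DepletionAtTwo.KummerSigma

/-! ### §1 A square root in `ℚ⟦X⟧` -/

/-- A rational power series with constant term `1` is a square: `F = B²` with `B(0) = 1` (`B = (1+X)^{1/2} ∘ (F − 1)`).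
[folklore] -/
theorem exists_sqrt_of_constantCoeff_eq_one (F : PowerSeries ℚ) (hF : constantCoeff F = 1) :
    ∃ B : PowerSeries ℚ, constantCoeff B = 1 ∧ B ^ 2 = F := by
  set G : PowerSeries ℚ := F - 1 with hG
  have hG0 : constantCoeff G = 0 := by rw [hG, map_sub, hF, map_one, sub_self]
  have hs : HasSubst G := HasSubst.of_constantCoeff_zero' hG0
  refine ⟨(PowerSeries.binomialSeries ℚ (2 : ℚ)⁻¹).subst G, ?_, ?_⟩
  · rw [Literature.RingTheory.PowerSeries.constantCoeff_subst_of_constantCoeff_eq_zero hG0,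
      PowerSeries.binomialSeries_constantCoeff]
  · rw [← subst_pow hs, show ((2 : ℚ)⁻¹) = ((2 : ℕ) : ℚ)⁻¹ by norm_num,
      Literature.RingTheory.PowerSeries.binomialSeries_inv_pow two_ne_zero, subst_add hs,
      ← map_one (C : ℚ →+* PowerSeries ℚ), subst_C, subst_X hs, hG]
    simp

/-! ### §2 The stub -/

/-- **Stub K-A `stub_kummerSqrtFormSigma` of line `kummer` v7 (crux `StarGO2Sigma`, stmt-BirchSwinnertonDyer-27046), registered
signature verbatim — PROVED.**  See the file docstring. [cite: ShimuraIATAF1971, §2.4 and Thm. 7.14] [cite: SilvermanAEC2009, VI.3.6] -/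
theorem stub_kummerSqrtFormSigma :
    ∀ (W₀ : WeierstrassCurve ℚ) [W₀.IsElliptic] [W₀.IsGloballyMinimal]
      ⦃N : ℕ⦄ [NeZero N] (f : CuspForm (Gamma0 N) 2), IsNewformOf W₀ f → 5 ≤ N →
      ∀ (L₀ : PeriodPair), IsNeronLatticeOf (W₀.baseChange ℂ) L₀ →
      ∀ (q : ℤ), q ≠ 0 → (∀ z ∈ periodLattice f, (q : ℂ) * z ∈ L₀.lattice) →
      ∀ (x₀ : ℚ), HasRationalTwoTorsionX W₀ x₀ →
      ∀ (lam : ℂ), lam ∈ L₀.lattice → lam / 2 ∉ L₀.lattice →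
        L₀.weierstrassP (lam / 2) - ((W₀.b₂ : ℚ) : ℂ) / 12 = ((x₀ : ℚ) : ℂ) →
      ∀ (β : ℕ → ℕ) (g' : ℚ), g' ≠ 0 →
        (∀ γ : SL(2, ℤ), γ ∈ Gamma1 N → ∃ n : ℤ, stabEisensteinPeriod N β (γ 0 0) (γ 0 1) (γ 1 0) (γ 1 1) = n * g') →
        (∀ γ : SL(2, ℤ), γ ∈ Gamma1 N → (γ : Matrix (Fin 2) (Fin 2) ℤ).trace = 2 →
          ∃ n : ℤ, stabEisensteinPeriod N β (γ 0 0) (γ 0 1) (γ 1 0) (γ 1 1) = n * g' ∧ Even n) →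
      ∀ (Γ'' : Subgroup SL(2, ℤ)),
        (∀ γ : SL(2, ℤ), γ ∈ Γ'' ↔ ∃ hγ : γ ∈ Gamma0 N, γ ∈ Gamma1 N ∧
          ((∃ n : ℤ, stabEisensteinPeriod N β (γ 0 0) (γ 0 1) (γ 1 0) (γ 1 1) = n * g' ∧ Even n) ↔
            ∃ k : ℤ, ∃ w ∈ L₀.lattice, (q : ℂ) * cuspSymbol f ⟨γ, hγ⟩ = (k : ℂ) * lam + 2 * w)) →
      ∀ (m : ℕ) (V : ModularForm (Gamma0 N) ((24 * m : ℕ) : ℤ)) (u : UpperHalfPlane → ℂ)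
        (U : PowerSeries ℚ) (E : PowerSeries ℤ),
        MDifferentiable 𝓘(ℂ) 𝓘(ℂ) u → (∀ τ : UpperHalfPlane, u τ ≠ 0) → (∀ τ : UpperHalfPlane, u τ ^ 2 = V τ) →
        (∀ γ : SL(2, ℤ), γ ∈ Gamma0 N → ∀ n : ℤ,
          stabEisensteinPeriod N β (γ 0 0) (γ 0 1) (γ 1 0) (γ 1 1) = n * g' →
            u ∣[((12 * m : ℕ) : ℤ)] γ = ((-1 : ℂ) ^ n.natAbs) • u) →
        PowerSeries.constantCoeff U = 1 →
        (∀ n : ℕ, PowerSeries.coeff n (UpperHalfPlane.qExpansion (1 : ℝ) u) = ((PowerSeries.coeff n U : ℚ) : ℂ)) →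
        PowerSeries.constantCoeff E = 1 →
        U ^ 2 = PowerSeries.map (Int.castRingHom ℚ) (PowerSeries.X ^ (2 * m) * kummerThetaSeries N * E ^ 2) →
      ∀ (R : PowerSeries ℤ), PowerSeries.constantCoeff R = 1 →
        PowerSeries.C ((q : ℚ) ^ 2) * PowerSeries.map (Int.castRingHom ℚ) (kummerThetaSeries N) *
            PowerSeries.X ^ 2 *
            (W₀.formalXMulSq - PowerSeries.C x₀ * PowerSeries.X ^ 2).subst
              (W₀.formalExp.subst ((q : ℚ) • (PowerSeries.mk fun j : ℕ ↦ ((W₀.LFunction j : ℤ) : ℚ) / j))) =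
          (W₀.formalExp.subst ((q : ℚ) • (PowerSeries.mk fun j : ℕ ↦ ((W₀.LFunction j : ℤ) : ℚ) / j))) ^ 2 *
            PowerSeries.map (Int.castRingHom ℚ) R ^ 2 →
      ∀ (zq : PowerSeries ℤ),
        PowerSeries.map (Int.castRingHom ℚ) zq =
          W₀.formalExp.subst ((q : ℚ) • (PowerSeries.mk fun j : ℕ ↦ ((W₀.LFunction j : ℤ) : ℚ) / j)) →
        (∃ A : ℝ, ∀ τ : UpperHalfPlane, A < τ.im →
          HasSum (fun n : ℕ ↦ ((PowerSeries.coeff n zq : ℤ) : ℂ) *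
              Complex.exp (2 * Real.pi * Complex.I * (τ : ℂ)) ^ n)
            (-(L₀.weierstrassP ((q : ℂ) * eichlerIntegral f τ) - ((W₀.b₂ : ℚ) : ℂ) / 12) /
              ((L₀.derivWeierstrassP ((q : ℂ) * eichlerIntegral f τ)
                - ((W₀.a₁ : ℚ) : ℂ) * (L₀.weierstrassP ((q : ℂ) * eichlerIntegral f τ) - ((W₀.b₂ : ℚ) : ℂ) / 12)
                - ((W₀.a₃ : ℚ) : ℂ)) / 2))) →
      (∀ (k : ℤ), 1 ≤ k → ∀ (F : CuspForm (Gamma1 N) k),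
        (∀ n : ℕ, ∃ r : ℚ, PowerSeries.coeff n (UpperHalfPlane.qExpansion (1 : ℝ) F) = (r : ℂ)) →
        ∃ D : ℕ, D ≠ 0 ∧ ∀ n : ℕ, ∃ z : ℤ,
          PowerSeries.coeff n
            (UpperHalfPlane.qExpansion (1 : ℝ) (fun τ : UpperHalfPlane ↦ (D : ℂ) * F τ)) = (z : ℂ)) →
      ∃ (k : ℤ) (h : CuspForm Γ'' k) (M : ℕ),
        (h : UpperHalfPlane → ℂ) ≠ 0 ∧
        (∀ γ ∈ Gamma1 N, γ ∉ Γ'' → (h : UpperHalfPlane → ℂ) ∣[k] γ = -h) ∧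
        M ≠ 0 ∧
        ∀ n : ℕ, ∃ z : ℤ,
          PowerSeries.coeff n
            (UpperHalfPlane.qExpansion (1 : ℝ) (fun τ : UpperHalfPlane ↦ (M : ℂ) * h τ)) = (z : ℂ) := by
  intro W₀ _ _ N _ f hW₀ _h5 L₀ hL₀ q hq hin x₀ hx₀ lam hlam hlam2 hwp β g' hg0 hper hcusp Γ'' hΓ'' m V u U E
    hud hune husq humul hU1 hUq hE1 hUsq R hR1 hR zq hzq hzsum hS4
  ------------------------------------------------------------------
  -- casts: the rational scale `c₁ = q`
  ------------------------------------------------------------------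
  set c₁ : ℚ := (q : ℚ) with hc₁
  have hc₁0 : c₁ ≠ 0 := by rw [hc₁]; exact_mod_cast hq
  have hcast : ((c₁ : ℚ) : ℂ) = (q : ℂ) := by rw [hc₁, Rat.cast_intCast]
  have hin₁ : ∀ z ∈ periodLatticeGamma1 f, (c₁ : ℂ) * z ∈ L₀.lattice := fun z hz ↦ by
    rw [hcast]; exact hin z (periodLatticeGamma1_le_periodLattice f hz)
  have hΓ''c : ∀ γ : SL(2, ℤ), γ ∈ Γ'' ↔ ∃ hγ : γ ∈ Gamma0 N, γ ∈ Gamma1 N ∧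
      ((∃ n : ℤ, stabEisensteinPeriod N β (γ 0 0) (γ 0 1) (γ 1 0) (γ 1 1) = n * g' ∧ Even n) ↔
        ∃ k : ℤ, ∃ w ∈ L₀.lattice, (c₁ : ℂ) * cuspSymbol f ⟨γ, hγ⟩ = (k : ℂ) * lam + 2 * w) := by
    intro γ; rw [hΓ'' γ, hcast]
  ------------------------------------------------------------------
  -- the engines: Kummer function, Γ₁-denominator, untwisted parity group, Kummer form, twisted form
  ------------------------------------------------------------------
  obtain ⟨g, hg1, hg2, hg3⟩ := KummerFn.stub_kummerFn L₀ lam hlam hlam2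
  obtain ⟨k, G₁, Φ₁, hk1, hG0, hGrat, hΦ⟩ := X1Denominator.stub_x1Denominator W₀ f hW₀ L₀ hL₀ c₁ hc₁0 hin₁
  obtain ⟨Γ', hΓ'⟩ := ParityGroup.exists_parityGroup f L₀ c₁ hin₁ hlam hlam2
  obtain ⟨hκ, hκ0, hanti, hsq⟩ :=
    KummerForm.stub_kummerForm W₀ f hW₀ L₀ hL₀ c₁ hc₁0 hin₁ x₀ lam hlam hlam2 hwp Γ' hΓ' g hg1 hg2 hg3 k G₁ Φ₁ hG0 hΦ
  set Ψ : CuspForm (Gamma1 N) k := Φ₁ - (((x₀ : ℚ) : ℂ)) • G₁ with hΨ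
  have hΨapply : ∀ τ : ℍ, Ψ τ = Φ₁ τ - ((x₀ : ℚ) : ℂ) * G₁ τ := fun τ ↦ by
    simp [hΨ, CuspForm.sub_apply, CuspForm.IsGLPos.smul_apply, smul_eq_mul]
  have hsq' : ∀ τ : ℍ, hκ τ ^ 2 = Ψ τ * G₁ τ := fun τ ↦ by rw [hsq τ, hΨapply]
  have hw : ((24 * m : ℕ) : ℤ) = ((12 * m : ℕ) : ℤ) + ((12 * m : ℕ) : ℤ) := by push_cast; ring
  set V' : ModularForm (Gamma0 N) (((12 * m : ℕ) : ℤ) + ((12 * m : ℕ) : ℤ)) := ModularForm.mcast hw V with hV'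
  have husq' : ∀ τ : ℍ, u τ ^ 2 = V' τ := fun τ ↦ by rw [husq τ]; rfl
  obtain ⟨h, hhdef, hh0, hhanti, hhq⟩ :=
    twistedCuspForm f L₀ c₁ lam β g' hg0 hper hcusp hΓ' hΓ''c V' u hud hune husq' humul hκ hκ0 hanti Ψ G₁ hsq'
  ------------------------------------------------------------------
  -- the `q`-expansion identities (KummerQExp) with `B² = X − x₀T²`
  ------------------------------------------------------------------
  have hT' : ModularGroup.T ∈ Γ' := ParityGroup.mem_of_trace_eq_two f L₀ c₁ lam hΓ' (UBD.T_mem_Gamma1 N) trace_T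
  obtain ⟨B, hB0, hBsq⟩ : ∃ B : PowerSeries ℚ, constantCoeff B = 1 ∧ B ^ 2 = W₀.formalXMulSq - C x₀ * X ^ 2 := by
    apply exists_sqrt_of_constantCoeff_eq_one
    rw [map_sub, map_mul, map_pow, constantCoeff_X, zero_pow two_ne_zero, mul_zero, sub_zero,
      WeierstrassCurve.constantCoeff_formalXMulSq]
  obtain ⟨hZ0, hZ1, -⟩ := ParamExpansion.stub_paramExpansion W₀ f hW₀ L₀ hL₀ c₁ hc₁0
  have hz0 : constantCoeff zq = 0 := by
    have h0 := congrArg constantCoeff hzq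
    rw [constantCoeff_map', hZ0, eq_intCast, Int.cast_eq_zero] at h0
    exact h0
  have hz1 : coeff 1 zq ≠ 0 := by
    intro h0
    have h1 := congrArg (coeff 1) hzq
    rw [coeff_map, h0, map_zero, hZ1] at h1
    exact hc₁0 h1.symm
  have hzsum' : ∃ A : ℝ, ∀ τ : UpperHalfPlane, A < τ.im →
      HasSum (fun n : ℕ ↦ ((PowerSeries.coeff n zq : ℤ) : ℂ) * Complex.exp (2 * Real.pi * Complex.I * (τ : ℂ)) ^ n)
        (-(L₀.weierstrassP ((c₁ : ℂ) * eichlerIntegral f τ) - ((W₀.b₂ : ℚ) : ℂ) / 12) /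
          ((L₀.derivWeierstrassP ((c₁ : ℂ) * eichlerIntegral f τ)
            - ((W₀.a₁ : ℚ) : ℂ) * (L₀.weierstrassP ((c₁ : ℂ) * eichlerIntegral f τ) - ((W₀.b₂ : ℚ) : ℂ) / 12)
            - ((W₀.a₃ : ℚ) : ℂ)) / 2)) := by
    rw [hcast]; exact hzsum
  obtain ⟨hi, hii, hlinh, hlinΦ⟩ :=
    KummerQExp.stub_kummerQExp W₀ f hW₀ L₀ hL₀ c₁ hc₁0 x₀ B hB0 hBsq zq hz0 hz1 hzsum' k G₁ Φ₁ hΦ Γ' hT' hκ hsq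
  ------------------------------------------------------------------
  -- names for the series
  ------------------------------------------------------------------
  set zQ : PowerSeries ℚ := PowerSeries.map (Int.castRingHom ℚ) zq with hzQ
  set zC : PowerSeries ℂ := PowerSeries.map (Int.castRingHom ℂ) zq with hzC
  set Xz : PowerSeries ℚ := W₀.formalXMulSq.subst zQ with hXz
  set Bz : PowerSeries ℚ := B.subst zQ with hBz
  set PΦ : PowerSeries ℂ := qExpansion 1 (Φ₁ : ℍ → ℂ) with hPΦ
  set PG : PowerSeries ℂ := qExpansion 1 (G₁ : ℍ → ℂ) with hPG
  set Pκ : PowerSeries ℂ := qExpansion 1 (hκ : ℍ → ℂ) with hPκ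
  set PU : PowerSeries ℂ := PowerSeries.map (algebraMap ℚ ℂ) U with hPU
  have hinj : Function.Injective (algebraMap ℚ ℂ) := (algebraMap ℚ ℂ).injective
  have hzQ0 : constantCoeff zQ = 0 := by rw [hzQ, constantCoeff_map', hz0, map_zero]
  have hsQ : HasSubst zQ := HasSubst.of_constantCoeff_zero' hzQ0
  have hzCQ : PowerSeries.map (algebraMap ℚ ℂ) zQ = zC := map_rat_map_int zq
  -- `qExpansion 1 u = PU`
  have hPUeq : qExpansion 1 u = PU := by
    ext n
    rw [hUq n, hPU, coeff_map, eq_ratCast]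
  -- `zq = X * v`, `v(0) ≠ 0`
  obtain ⟨v, hv⟩ : X ∣ zq := X_dvd_iff.mpr hz0
  have hv0 : constantCoeff v ≠ 0 := by
    have h1 := congrArg (coeff 1) hv
    rw [coeff_succ_X_mul, coeff_zero_eq_constantCoeff] at h1
    rwa [h1] at hz1
  have hzC_eq : zC = X * PowerSeries.map (Int.castRingHom ℂ) v := by
    rw [hzC, hv, map_mul, map_X]
  have hzC_ne : zC ≠ 0 := by
    intro h0
    have h1 := congrArg (coeff 1) h0
    rw [hzC, coeff_map, map_zero, eq_intCast, Int.cast_eq_zero] at h1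
    exact hz1 h1
  ------------------------------------------------------------------
  -- (a) rationality of `PΦ` (as in `KummerAlg.stub_kummerAlg`)
  ------------------------------------------------------------------
  obtain ⟨PGq, hPGq⟩ := exists_map_eq_of_forall_rat hGrat
  have hRat : PΦ * (PowerSeries.map (Int.castRingHom ℂ) v) ^ 2 * X ^ 2 = PowerSeries.map (algebraMap ℚ ℂ) (Xz * PGq) := by
    rw [map_mul, hPGq, ← hi, hzC_eq]
    ring
  have hlow : ∀ m' < 2, coeff m' (Xz * PGq) = 0 := by
    intro m' hm'
    apply hinj
    rw [← coeff_map, ← hRat, coeff_mul_X_pow', if_neg (by omega), map_zero]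
  obtain ⟨Q, hQ⟩ : X ^ 2 ∣ Xz * PGq := X_pow_dvd_iff.mpr hlow
  have hPΦv : PΦ * (PowerSeries.map (Int.castRingHom ℂ) v) ^ 2 = PowerSeries.map (algebraMap ℚ ℂ) Q := by
    have h1 : PΦ * (PowerSeries.map (Int.castRingHom ℂ) v) ^ 2 * X ^ 2 = PowerSeries.map (algebraMap ℚ ℂ) Q * X ^ 2 := by
      rw [hRat, hQ, map_mul, map_pow, map_X, mul_comm]
    exact mul_right_cancel₀ (pow_ne_zero 2 X_ne_zero) h1
  set vQ : PowerSeries ℚ := PowerSeries.map (Int.castRingHom ℚ) v with hvQ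
  have hvQ0 : constantCoeff vQ ≠ 0 := by
    rw [hvQ, constantCoeff_map', eq_intCast]
    exact_mod_cast hv0
  have hvC : PowerSeries.map (algebraMap ℚ ℂ) vQ = PowerSeries.map (Int.castRingHom ℂ) v := map_rat_map_int v
  have hPΦrat_eq : PΦ = PowerSeries.map (algebraMap ℚ ℂ) (Q * (vQ⁻¹) ^ 2) := by
    have hne : (PowerSeries.map (Int.castRingHom ℂ) v) ^ 2 ≠ 0 := by
      refine pow_ne_zero 2 fun h0 ↦ hv0 ?_
      have h1 := congrArg constantCoeff h0
      rw [constantCoeff_map', map_zero, eq_intCast, Int.cast_eq_zero] at h1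
      exact h1
    refine mul_right_cancel₀ hne ?_
    rw [hPΦv, ← hvC, ← map_pow, ← map_mul, mul_assoc, ← mul_pow, PowerSeries.inv_mul_cancel vQ hvQ0, one_pow,
      mul_one]
  have hΦrat : ∀ n : ℕ, ∃ r : ℚ, coeff n (qExpansion 1 (Φ₁ : ℍ → ℂ)) = (r : ℂ) := fun n ↦ by
    rw [← hPΦ, hPΦrat_eq]; exact forall_rat_of_map _ n
  -- bounded denominators for `Φ₁`
  obtain ⟨D, hD0, hDint⟩ := hS4 k hk1 Φ₁ hΦrat
  have hDint' : ∀ n : ℕ, ∃ z : ℤ, coeff n (C (D : ℂ) * PΦ) = (z : ℂ) := by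
    intro n
    rw [hPΦ, ← hlinΦ (D : ℂ)]
    exact hDint n
  obtain ⟨TΦ, hTΦ⟩ := exists_map_eq_of_forall_int hDint'
  ------------------------------------------------------------------
  -- (b) the square identity `(q·X·P(h))² = (X^m·E·R·PG)²`
  ------------------------------------------------------------------
  -- `Bz² = (X_W − x₀T²)(Z)` and the (Θ) identity over `ℂ`
  have hBz2 : Bz ^ 2 = (W₀.formalXMulSq - C x₀ * X ^ 2).subst zQ := by
    rw [hBz, ← subst_pow hsQ, hBsq]
  have hΘC : C ((q : ℂ) ^ 2) * PowerSeries.map (Int.castRingHom ℂ) (kummerThetaSeries N) * X ^ 2 *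
      (PowerSeries.map (algebraMap ℚ ℂ) Bz) ^ 2 = zC ^ 2 * (PowerSeries.map (Int.castRingHom ℂ) R) ^ 2 := by
    have h1 := congrArg (PowerSeries.map (algebraMap ℚ ℂ)) hR
    rw [← hzq, ← hBz2] at h1
    simp only [map_mul, map_pow, map_C, map_X, map_rat_map_int, eq_ratCast] at h1
    rw [hc₁, Rat.cast_intCast, hzCQ] at h1
    rw [map_pow]
    exact h1
  -- `PU² = X^{2m}·Θ·E²`
  have hPU2 : PU ^ 2 = X ^ (2 * m) * PowerSeries.map (Int.castRingHom ℂ) (kummerThetaSeries N) *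
      (PowerSeries.map (Int.castRingHom ℂ) E) ^ 2 := by
    rw [hPU, ← map_pow, hUsq, map_rat_map_int, map_mul, map_mul, map_pow, map_pow, map_X]
  -- `P(h) = PU · Pκ`
  have hPh : qExpansion 1 (h : ℍ → ℂ) = PU * Pκ := by rw [hhq, hPUeq]
  -- `(zB(z))² PG²` over `ℂ`
  have hii' : Pκ ^ 2 * zC ^ 4 = (zC * PowerSeries.map (algebraMap ℚ ℂ) Bz) ^ 2 * PG ^ 2 := by
    have h2 := hii
    rw [map_mul, hzCQ] at h2
    exact h2
  have hsqid : (C (q : ℂ) * X * qExpansion 1 (h : ℍ → ℂ)) * (C (q : ℂ) * X * qExpansion 1 (h : ℍ → ℂ)) * zC ^ 4 =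
      (X ^ m * PowerSeries.map (Int.castRingHom ℂ) E * PowerSeries.map (Int.castRingHom ℂ) R * PG) *
        (X ^ m * PowerSeries.map (Int.castRingHom ℂ) E * PowerSeries.map (Int.castRingHom ℂ) R * PG) * zC ^ 4 := by
    have e1 : (C (q : ℂ) * X * qExpansion 1 (h : ℍ → ℂ)) * (C (q : ℂ) * X * qExpansion 1 (h : ℍ → ℂ)) * zC ^ 4 =
        C ((q : ℂ) ^ 2) * X ^ 2 * PU ^ 2 * (Pκ ^ 2 * zC ^ 4) := by
      rw [hPh, map_pow]; ring
    rw [e1, hii', hPU2]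
    have e2 : C ((q : ℂ) ^ 2) * X ^ 2 *
        (X ^ (2 * m) * PowerSeries.map (Int.castRingHom ℂ) (kummerThetaSeries N) * (PowerSeries.map (Int.castRingHom ℂ) E) ^ 2) *
        ((zC * PowerSeries.map (algebraMap ℚ ℂ) Bz) ^ 2 * PG ^ 2) =
        X ^ (2 * m) * (PowerSeries.map (Int.castRingHom ℂ) E) ^ 2 * PG ^ 2 * zC ^ 2 *
          (C ((q : ℂ) ^ 2) * PowerSeries.map (Int.castRingHom ℂ) (kummerThetaSeries N) * X ^ 2 *
            (PowerSeries.map (algebraMap ℚ ℂ) Bz) ^ 2) := by ring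
    rw [e2, hΘC]
    ring
  have hsq2 := mul_right_cancel₀ (pow_ne_zero 4 hzC_ne) hsqid
  -- a sign `ε = ±1`
  obtain ⟨ε, hε⟩ : ∃ ε : ℤ, C (q : ℂ) * X * qExpansion 1 (h : ℍ → ℂ) =
      C (ε : ℂ) * (X ^ m * PowerSeries.map (Int.castRingHom ℂ) E * PowerSeries.map (Int.castRingHom ℂ) R * PG) := by
    rcases mul_self_eq_mul_self_iff.mp hsq2 with h1 | h1
    · exact ⟨1, by rw [h1, Int.cast_one, map_one, one_mul]⟩
    · exact ⟨-1, by rw [h1, Int.cast_neg, Int.cast_one, map_neg, map_one, neg_one_mul]⟩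
  ------------------------------------------------------------------
  -- (c) integrality: `PG = PΦ·z²·X(z)⁻¹`, `D·PΦ ∈ ℤ⟦q⟧`, `z = X·v`
  ------------------------------------------------------------------
  obtain ⟨Xℤ, hXℤ0, hXℤ⟩ := exists_int_formalXMulSq W₀
  set Xℤz : PowerSeries ℤ := Xℤ.subst zq with hXℤz
  have hXℤz_map : PowerSeries.map (Int.castRingHom ℂ) Xℤz = PowerSeries.map (algebraMap ℚ ℂ) Xz := by
    rw [hXℤz, map_int_subst hz0, hXz, map_rat_subst hzQ0, ← hXℤ]
    simp only [hzQ, map_rat_map_int]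
  have hXℤz0 : constantCoeff Xℤz = 1 := by
    rw [hXℤz, Literature.RingTheory.PowerSeries.constantCoeff_subst_of_constantCoeff_eq_zero hz0, hXℤ0]
  set Y : PowerSeries ℤ := Xℤz.invOfUnit 1 with hY
  have hXY : Xℤz * Y = 1 := PowerSeries.mul_invOfUnit Xℤz 1 (by rw [hXℤz0, Units.val_one])
  have hPGeq : PG = PΦ * zC ^ 2 * PowerSeries.map (Int.castRingHom ℂ) Y := by
    calc PG = PG * PowerSeries.map (Int.castRingHom ℂ) (Xℤz * Y) := by rw [hXY, map_one, mul_one]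
      _ = (PowerSeries.map (algebraMap ℚ ℂ) Xz * PG) * PowerSeries.map (Int.castRingHom ℂ) Y := by
          rw [map_mul, hXℤz_map]; ring
      _ = PΦ * zC ^ 2 * PowerSeries.map (Int.castRingHom ℂ) Y := by rw [← hi]
  -- assemble: `C(qD)·X·P(h) = X · (integer series)`
  have hmain : C ((q : ℂ) * D) * X * qExpansion 1 (h : ℍ → ℂ) =
      C (ε : ℂ) * X * PowerSeries.map (Int.castRingHom ℂ) (X ^ m * E * R * Y * TΦ * X * v ^ 2) := by
    have e1 : C ((q : ℂ) * D) * X * qExpansion 1 (h : ℍ → ℂ) = C (D : ℂ) * (C (q : ℂ) * X * qExpansion 1 (h : ℍ → ℂ)) := by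
      rw [map_mul]; ring
    have hTΦ' : C (D : ℂ) * PΦ = PowerSeries.map (Int.castRingHom ℂ) TΦ := hTΦ.symm
    rw [e1, hε, hPGeq, hzC_eq]
    simp only [map_mul, map_pow, map_X]
    linear_combination (C (ε : ℂ) * X ^ m * PowerSeries.map (Int.castRingHom ℂ) E * PowerSeries.map (Int.castRingHom ℂ) R *
      X ^ 2 * (PowerSeries.map (Int.castRingHom ℂ) v) ^ 2 * PowerSeries.map (Int.castRingHom ℂ) Y) * hTΦ'
  -- cancel `X`
  have hmain' : C ((q : ℂ) * D) * qExpansion 1 (h : ℍ → ℂ) =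
      C (ε : ℂ) * PowerSeries.map (Int.castRingHom ℂ) (X ^ m * E * R * Y * TΦ * X * v ^ 2) := by
    have h1 : C ((q : ℂ) * D) * qExpansion 1 (h : ℍ → ℂ) * X =
        C (ε : ℂ) * PowerSeries.map (Int.castRingHom ℂ) (X ^ m * E * R * Y * TΦ * X * v ^ 2) * X := by
      have h2 := hmain
      calc C ((q : ℂ) * D) * qExpansion 1 (h : ℍ → ℂ) * X = C ((q : ℂ) * D) * X * qExpansion 1 (h : ℍ → ℂ) := by ring
        _ = C (ε : ℂ) * X * PowerSeries.map (Int.castRingHom ℂ) (X ^ m * E * R * Y * TΦ * X * v ^ 2) := h2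
        _ = C (ε : ℂ) * PowerSeries.map (Int.castRingHom ℂ) (X ^ m * E * R * Y * TΦ * X * v ^ 2) * X := by ring
    exact mul_right_cancel₀ X_ne_zero h1
  ------------------------------------------------------------------
  -- (d) conclusion with `M = |q|·D`
  ------------------------------------------------------------------
  obtain ⟨s, hsq⟩ : ∃ s : ℤ, ((q.natAbs : ℤ) : ℂ) = (s : ℂ) * (q : ℂ) := by
    rcases Int.natAbs_eq q with h1 | h1
    · exact ⟨1, by rw [Int.cast_one, one_mul, ← h1]⟩
    · refine ⟨-1, ?_⟩
      have h2 : (q.natAbs : ℤ) = -q := by omega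
      rw [h2]; push_cast; ring
  refine ⟨((12 * m : ℕ) : ℤ) + k, h, q.natAbs * D, hh0, hhanti,
    Nat.mul_ne_zero (Int.natAbs_ne_zero.mpr hq) hD0, fun n ↦ ?_⟩
  -- linearity of the `q`-expansion of `h`
  have hTΓ'' : ModularGroup.T ∈ Γ'' := by
    obtain ⟨hT0, hT1, hTκ⟩ := (hΓ' _).mp hT'
    obtain ⟨nT, hnT, hnTe⟩ := hcusp _ (UBD.T_mem_Gamma1 N) trace_T
    exact (hΓ''c _).mpr ⟨hT0, hT1, ⟨fun _ ↦ hTκ, fun _ ↦ ⟨nT, hnT, hnTe⟩⟩⟩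
  have hhT : (h : ℍ → ℂ) ∣[((12 * m : ℕ) : ℤ) + k] ModularGroup.T = h :=
    SlashInvariantForm.slash_action_eqn h _ ⟨ModularGroup.T, hTΓ'', rfl⟩
  have hh_per : Function.Periodic ((h : ℍ → ℂ) ∘ ofComplex) 1 := periodic_of_slash_T hhT
  have hh_bdd : IsBoundedAtImInfty (h : ℍ → ℂ) := by
    refine (isZeroAtImInfty_of_norm_sq' (V := fun τ ↦ V τ * (Ψ τ * G₁ τ)) (fun τ ↦ ?_) ?_).boundedAtFilter
    · rw [hhdef τ, norm_mul, mul_pow, ← norm_pow, ← norm_pow, husq τ, hsq' τ, ← norm_mul]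
    · exact isZeroAtImInfty_mul_of_bdd (isBoundedAtImInfty_modularForm_gamma0 V)
        (isZeroAtImInfty_mul_of_bdd (isZeroAtImInfty_cuspForm_gamma1 Ψ).boundedAtFilter
          (isZeroAtImInfty_cuspForm_gamma1 G₁))
  have hh_an : AnalyticAt ℂ (cuspFunction 1 (h : ℍ → ℂ)) 0 :=
    UpperHalfPlane.analyticAt_cuspFunction_zero one_pos hh_per h.holo' hh_bdd
  have hlin : qExpansion (1 : ℝ) (fun τ : ℍ ↦ ((q.natAbs * D : ℕ) : ℂ) * h τ) =
      C (((q.natAbs * D : ℕ) : ℂ)) * qExpansion 1 (h : ℍ → ℂ) := by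
    have hfun : (fun τ : ℍ ↦ ((q.natAbs * D : ℕ) : ℂ) * h τ) = ((q.natAbs * D : ℕ) : ℂ) • (h : ℍ → ℂ) := by
      funext τ; simp [smul_eq_mul]
    rw [hfun, UpperHalfPlane.qExpansion_smul hh_an, smul_eq_C_mul]
  have hfinal : C (((q.natAbs * D : ℕ) : ℂ)) * qExpansion 1 (h : ℍ → ℂ) =
      PowerSeries.map (Int.castRingHom ℂ) (PowerSeries.C (s * ε : ℤ) * (X ^ m * E * R * Y * TΦ * X * v ^ 2)) := by
    have e1 : C (((q.natAbs * D : ℕ) : ℂ)) * qExpansion 1 (h : ℍ → ℂ) = C (s : ℂ) * (C ((q : ℂ) * D) * qExpansion 1 (h : ℍ → ℂ)) := by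
      rw [Nat.cast_mul, ← Int.cast_natCast q.natAbs, hsq, map_mul, map_mul, map_mul]
      ring
    have e2 : PowerSeries.map (Int.castRingHom ℂ) (PowerSeries.C (s * ε : ℤ) * (X ^ m * E * R * Y * TΦ * X * v ^ 2)) =
        C (s : ℂ) * C (ε : ℂ) * PowerSeries.map (Int.castRingHom ℂ) (X ^ m * E * R * Y * TΦ * X * v ^ 2) := by
      rw [map_mul, PowerSeries.map_C, eq_intCast, Int.cast_mul, map_mul]
    rw [e1, hmain', e2]
    ring
  exact ⟨coeff n (PowerSeries.C (s * ε : ℤ) * (X ^ m * E * R * Y * TΦ * X * v ^ 2)),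
    by rw [hlin, hfinal, coeff_map, eq_intCast]⟩

end Summit.BirchSwinnertonDyer.BirchSwinnertonDyer.Theorems.DepletionAtTwo.KummerSigma

end
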